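import Mathlib.RingTheory.Ideal.Quotient.Operations
import Mathlib.GroupTheory.Coset.Card
import Mathlib.GroupTheory.QuotientGroup.Basic
import Mathlib.SetTheory.Cardinal.Finite
import HarnessLib

/-!
# `#(R/aʳ) = #(R/a)ʳ` for a non-zero-divisor `a`
# (cell `b2b-bsdres`, team n1011, row T-EPC = Tate's local Euler–Poincaré characteristic; seat p04 GEN 8; stage C4c)

HONEST FRAMING (cell `b2b-bsdres`, run/shared/lean/b2b/bsd-rank1-residual/, verbatim in every
file): the goal of the cell is to DELETE the COMBINATION-SHAPED residual classes of the
Birch–Swinnerton-Dyer formula for ALL analytic-rank `≤ 1` elliptic curves over `ℚ` — "full BSD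
formula for every rank `≤ 1` curve in class `C`" assembled STRICTLY from published theorems — so
that the rank-`≤ 1` remainder becomes exactly the CONSTRUCTION-SHAPED classes, which are TYPED
(missing-input `Prop`s), NOT attempted. This is not "finishing BSD". Team n1011 (N10 / N11, the
additive block X4 ∧ `p = 3`): research route; no claim beyond the stated classes; nothing is
booked; no mark / label is changed by this file. Theorems only (no definition, no named fact, no
`sorry`); TOOL theorem of commutative algebra.  (Placement: Summits/GaloisImage with the T-EPC
cone.)

## What

The factor `(R : mR)` of Tate's local Euler–Poincaré characteristic formula (Milne, *ADT* I
Thm. 2.8) for `m = #M = p^r` is `(R : pR)^r`; stage B of the T-EPC programme produces `#(𝒪_K/p)^r`.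
This file proves, for any commutative ring `R` and `a ∈ R` which is not a zero divisor:

* `QuotientPow.natCard_quotient_span_pow_succ` — `#(R/(a^{r+1})) = #(R/(a^r)) · #(R/(a))`
  (the exact sequence `0 → R/(a^r) →(·a) R/(a^{r+1}) → R/(a) → 0`);
* `QuotientPow.natCard_quotient_span_pow` — **`#(R/(a^r)) = #(R/(a))^r`**.

References: J. S. Milne, *Arithmetic Duality Theorems* (2006), I §2 Thm. 2.8 (the factor
`(R : mR)`) [MilneADT2006].
-/

noncomputable section

open Function

namespace Summit.BirchSwinnertonDyer.Rank1Residual.GaloisImage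

namespace QuotientPow

variable {R : Type*} [CommRing R] (a : R)

/-- `y ↦ a·y mod a^{r+1}` has kernel `(a^r)` when `a` is not a zero divisor, and image the kernel
of `R/(a^{r+1}) → R/(a)`. [folklore] -/
theorem natCard_quotient_span_pow_succ (ha : ∀ x : R, a * x = 0 → x = 0) (r : ℕ) :
    Nat.card (R ⧸ Ideal.span {a ^ (r + 1)}) =
      Nat.card (R ⧸ Ideal.span {a ^ r}) * Nat.card (R ⧸ Ideal.span {a}) := by
  classical
  set I : Ideal R := Ideal.span {a ^ (r + 1)} with hI
  set J : Ideal R := Ideal.span {a} with hJ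
  have hIJ : I ≤ J := by
    rw [hI, Ideal.span_singleton_le_iff_mem, hJ, Ideal.mem_span_singleton]
    exact Dvd.intro _ (pow_succ' a r).symm
  -- `f : R/I → R/J`
  let f : R ⧸ I →+ R ⧸ J := (Ideal.Quotient.factor hIJ).toAddMonoidHom
  have hf : ∀ y : R, f (Ideal.Quotient.mk I y) = Ideal.Quotient.mk J y := fun y => rfl
  have hfsurj : Surjective f := by
    intro x
    obtain ⟨y, rfl⟩ := Ideal.Quotient.mk_surjective x
    exact ⟨Ideal.Quotient.mk I y, hf y⟩
  -- `g : R → R/I`, `y ↦ a y`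
  let g : R →+ R ⧸ I := (Ideal.Quotient.mk I).toAddMonoidHom.comp (AddMonoidHom.mulLeft a)
  have hg : ∀ y : R, g y = Ideal.Quotient.mk I (a * y) := fun y => rfl
  have hgker : g.ker = (Ideal.span {a ^ r}).toAddSubgroup := by
    ext y
    rw [AddMonoidHom.mem_ker, hg, Ideal.Quotient.eq_zero_iff_mem, Submodule.mem_toAddSubgroup, hI,
      Ideal.mem_span_singleton', Ideal.mem_span_singleton']
    constructor
    · rintro ⟨z, hz⟩
      refine ⟨z, ?_⟩
      have h0 : a * (z * a ^ r - y) = 0 := by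
        rw [mul_sub, ← hz, pow_succ]; ring
      have := ha _ h0
      rwa [sub_eq_zero] at this
    · rintro ⟨z, rfl⟩
      exact ⟨z, by rw [pow_succ]; ring⟩
  have hgrange : g.range = f.ker := by
    ext x
    constructor
    · rintro ⟨y, rfl⟩
      rw [AddMonoidHom.mem_ker, hg, hf, Ideal.Quotient.eq_zero_iff_mem, hJ]
      exact Ideal.mem_span_singleton'.2 ⟨y, mul_comm y a⟩
    · intro hx
      obtain ⟨y, rfl⟩ := Ideal.Quotient.mk_surjective x
      rw [AddMonoidHom.mem_ker, hf, Ideal.Quotient.eq_zero_iff_mem, hJ, Ideal.mem_span_singleton'] at hx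
      obtain ⟨z, rfl⟩ := hx
      exact ⟨z, by rw [hg, mul_comm]⟩
  -- counting
  have h1 : Nat.card (R ⧸ I) = Nat.card ((R ⧸ I) ⧸ f.ker) * Nat.card f.ker :=
    AddSubgroup.card_eq_card_quotient_mul_card_addSubgroup f.ker
  have h2 : Nat.card ((R ⧸ I) ⧸ f.ker) = Nat.card (R ⧸ J) :=
    Nat.card_congr (QuotientAddGroup.quotientKerEquivOfSurjective f hfsurj).toEquiv
  have h3 : Nat.card f.ker = Nat.card (R ⧸ Ideal.span {a ^ r}) := by
    rw [← hgrange, ← Nat.card_congr (QuotientAddGroup.quotientKerEquivRange g).toEquiv,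
      Nat.card_congr (QuotientAddGroup.quotientAddEquivOfEq hgker).toEquiv]
    rfl
  rw [h1, h2, h3, mul_comm]

/-- **`#(R/(a^r)) = #(R/(a))^r`** for `a ∈ R` not a zero divisor (e.g. `a = p` in the valuation ring
of a `p`-adic field: `(𝒪 : p^r 𝒪) = (𝒪 : p𝒪)^r`). [cite: MilneADT2006, I §2 Thm 2.8 (the factor (R : mR))] -/
theorem natCard_quotient_span_pow (ha : ∀ x : R, a * x = 0 → x = 0) (r : ℕ) :
    Nat.card (R ⧸ Ideal.span {a ^ r}) = Nat.card (R ⧸ Ideal.span {a}) ^ r := by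
  induction r with
  | zero =>
    rw [pow_zero, pow_zero, Ideal.span_singleton_one]
    haveI : Subsingleton (R ⧸ (⊤ : Ideal R)) := Ideal.Quotient.subsingleton_iff.2 rfl
    exact Nat.card_of_subsingleton (0 : R ⧸ (⊤ : Ideal R))
  | succ r ih => rw [natCard_quotient_span_pow_succ a ha r, ih, pow_succ]

end QuotientPow

end Summit.BirchSwinnertonDyer.Rank1Residual.GaloisImage

end
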